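import Summits.AtomisticToContinuum.Crystallization.Theorems.ThreeConeCertificateSlackRigidityPricedFloorsS3Defs
import Summits.AtomisticToContinuum.Crystallization.Theorems.ThreeConeCertificateSlackRigidityPricedFloorsConvexWindows
import Summits.AtomisticToContinuum.Crystallization.Theorems.ThreeConeCertificateSlackRigidityPricedFloorsWindow
import Summits.AtomisticToContinuum.Crystallization.Theorems.ThreeConeCertificateSlackRigidityPricedFloorsWindowLower
import HarnessLib

/-!
# `SlackRigidity` (stmt-AtomisticToContinuum-11960), line `priced-floors-palm-exactification`, stub S3
# (`stub_layeredMeanSelection`), package (II): increment functionals, part 2 — convexity instance and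
# the edge bound

Lead c19, worker package (II), deterministic part 2.  With the inline functionals of part 1
(`LE e m`, `jump e i`, `AE n e`, `BE n e`, `DE e`, `DtE n e`) and the window average of squared
increment jumps

* `VE n e := (1/(2n+1)) (Σ_{l < 2n} jump e (−n + l) + Σ_{l < 2n} jump e (−n − 1 + l))`,

this file proves the two pointwise inequalities consumed by `lms_increments_ae_zero'`:

* `lms_convexity_instance` (registered) — `∃ κ > 0, C ≥ 0` with
  `4 e* − C/(2n+1) + κ · VE n e ≤ AE n e + BE n e` for all fault-free normal data: the landed
  `ConvexWindows.lms_convex_windows` (its window-bound hypothesis being `Window.lms_window_sum_ge`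
  applied to `WindowLower.stub_windowLowerBound`, frame suppressed) for the windows
  `(m₁, n) := (−n, 2n)` and `(−n−1, 2n)`, summed and divided by `2(2n+1)`;
* `lms_Dt_le` (registered) — `DtE n e ≤ 2 VE n e + 1/(2n+1)`: the index sets differ by the two edge
  jumps `jump e n`, `jump e (−n−2)`, each `≤ (7a/100)² ≤ 49/10⁴` on normal data;
* `lms_jump_functional_bounds` (registered) — `VE, DtE, DE ∈ [0, 1]` on normal data.

All `[folklore]` bookkeeping (finite-sum re-indexing and arithmetic).
-/

noncomputable section

open MeasureTheory Filter Set
open scoped BigOperators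

namespace Summit.AtomisticToContinuum.Crystallization.Theorems.SlackRigidityPricedFloorsIncrIdent

open Literature.MathematicalPhysics.StatisticalMechanics
open Summit.AtomisticToContinuum.Crystallization.Theorems.SlackRigidityPricedFloors
open Summit.AtomisticToContinuum.Crystallization.Theorems.MinimiserShells.Negative.LoadBearing (eStar)

/-! ## Finite-sum bookkeeping -/

/-- An integer interval as the image of a range: `Σ_{m ∈ [a, a+k]} f m = Σ_{l ≤ k} f (a + l)`.
[folklore] -/
theorem sum_Icc_eq_sum_range (f : ℤ → ℝ) (a : ℤ) (k : ℕ) :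
    ∑ m ∈ Finset.Icc a (a + k), f m = ∑ l ∈ Finset.range (k + 1), f (a + l) := by
  have himg : Finset.Icc a (a + k) = (Finset.range (k + 1)).image (fun l : ℕ => a + l) := by
    ext m
    simp only [Finset.mem_Icc, Finset.mem_image, Finset.mem_range]
    constructor
    · rintro ⟨h1, h2⟩
      exact ⟨(m - a).toNat, by omega, by omega⟩
    · rintro ⟨l, hl, rfl⟩
      omega
  rw [himg, Finset.sum_image (fun l _ l' _ h => by exact_mod_cast (add_right_inj a).1 h)]

/-- The symmetric window as a range: `Σ_{|m| ≤ n} f m = Σ_{l ≤ 2n} f (−n + l)`. [folklore] -/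
theorem sum_Icc_neg_eq_sum_range (f : ℤ → ℝ) (n : ℕ) :
    ∑ m ∈ Finset.Icc (-(n : ℤ)) n, f m = ∑ l ∈ Finset.range (2 * n + 1), f (-(n : ℤ) + l) := by
  rw [← sum_Icc_eq_sum_range f (-(n : ℤ)) (2 * n)]
  congr 1
  ext m
  simp only [Finset.mem_Icc]
  push_cast
  omega

/-- Splitting off the top jump: `Σ_{|m| ≤ n} jump m = Σ_{l < 2n} jump (−n + l) + jump n`. [folklore] -/
theorem sum_jump_split_top (z : ℤ → ℝ) (n : ℕ) :
    ∑ m ∈ Finset.Icc (-(n : ℤ)) n, ((z (m + 1) - z m) - (z (m + 2) - z (m + 1))) ^ 2 =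
      ∑ l ∈ Finset.range (2 * n), ((z (-(n : ℤ) + l + 1) - z (-(n : ℤ) + l)) -
        (z (-(n : ℤ) + l + 2) - z (-(n : ℤ) + l + 1))) ^ 2 +
      ((z ((n : ℤ) + 1) - z n) - (z ((n : ℤ) + 2) - z ((n : ℤ) + 1))) ^ 2 := by
  rw [sum_Icc_neg_eq_sum_range (fun m => ((z (m + 1) - z m) - (z (m + 2) - z (m + 1))) ^ 2) n,
    Finset.sum_range_succ]
  congr 1
  have h : -(n : ℤ) + ((2 * n : ℕ) : ℤ) = n := by push_cast; ring
  simp only [h]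

/-- Splitting off the bottom jump: `Σ_{|m| ≤ n} jump (m − 2) = jump (−n−2) + Σ_{l < 2n} jump (−n−1+l)`.
[folklore] -/
theorem sum_jump_split_bot (z : ℤ → ℝ) (n : ℕ) :
    ∑ m ∈ Finset.Icc (-(n : ℤ)) n, ((z (m - 1) - z (m - 2)) - (z m - z (m - 1))) ^ 2 =
      ((z (-(n : ℤ) - 1) - z (-(n : ℤ) - 2)) - (z (-(n : ℤ)) - z (-(n : ℤ) - 1))) ^ 2 +
      ∑ l ∈ Finset.range (2 * n), ((z (-(n : ℤ) - 1 + l + 1) - z (-(n : ℤ) - 1 + l)) -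
        (z (-(n : ℤ) - 1 + l + 2) - z (-(n : ℤ) - 1 + l + 1))) ^ 2 := by
  rw [sum_Icc_neg_eq_sum_range (fun m => ((z (m - 1) - z (m - 2)) - (z m - z (m - 1))) ^ 2) n,
    Finset.sum_range_succ', add_comm]
  congr 1
  · simp
  · refine Finset.sum_congr rfl fun l _ => ?_
    push_cast
    ring_nf

/-- An indicator weight restricts a sum to a sub-window. [folklore] -/
theorem sum_indicator_mul {s t : Finset ℤ} (h : t ⊆ s) (f : ℤ → ℝ) :
    ∑ m ∈ s, (if m ∈ t then (1 : ℝ) else 0) * f m = ∑ m ∈ t, f m := by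
  rw [← Finset.sum_subset h (fun m _ hm => by rw [if_neg hm, zero_mul])]
  exact Finset.sum_congr rfl fun m hm => by rw [if_pos hm, one_mul]

/-- The four windows of `lms_convex_windows` at `(m₁, n) = (−n, 2n)`, `(−n−1, 2n)` as symmetric
intervals. [folklore] -/
theorem windows_eq (n : ℕ) :
    Finset.Ico (-(n : ℤ)) (-(n : ℤ) + ((2 * n + 1 : ℕ) : ℤ)) = Finset.Icc (-(n : ℤ)) n ∧
    Finset.Ico (-(n : ℤ) + 1) (-(n : ℤ) + 1 + ((2 * n + 1 : ℕ) : ℤ)) = Finset.Icc (-(n : ℤ) + 1) ((n : ℤ) + 1) ∧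
    Finset.Ico (-(n : ℤ) - 1) (-(n : ℤ) - 1 + ((2 * n + 1 : ℕ) : ℤ)) = Finset.Icc (-(n : ℤ) - 1) ((n : ℤ) - 1) ∧
    Finset.Ico (-(n : ℤ) - 1 + 1) (-(n : ℤ) - 1 + 1 + ((2 * n + 1 : ℕ) : ℤ)) = Finset.Icc (-(n : ℤ)) n := by
  refine ⟨?_, ?_, ?_, ?_⟩ <;>
  · ext m
    simp only [Finset.mem_Ico, Finset.mem_Icc]
    push_cast
    omega

/-- **The arithmetic of the convexity instance**: the two instances of `lms_convex_windows` at the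
windows `(−n, 2n)` and `(−n−1, 2n)`, summed and divided by `2(2n+1)`. [folklore] -/
theorem convexity_arith {L : ℤ → ℝ} {J₁ J₂ κ C E : ℝ} {n : ℕ}
    (h1 : 4 * (((2 * n : ℕ) : ℝ) + 1) * E - C + 2 * κ * J₁ ≤
      ∑ m ∈ Finset.Icc (-(n : ℤ)) n, L m + ∑ m ∈ Finset.Icc (-(n : ℤ) + 1) ((n : ℤ) + 1), L m)
    (h2 : 4 * (((2 * n : ℕ) : ℝ) + 1) * E - C + 2 * κ * J₂ ≤
      ∑ m ∈ Finset.Icc (-(n : ℤ) - 1) ((n : ℤ) - 1), L m + ∑ m ∈ Finset.Icc (-(n : ℤ)) n, L m) :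
    4 * E - C / (2 * (n : ℝ) + 1) + κ * ((1 / (2 * (n : ℝ) + 1)) * (J₁ + J₂)) ≤
      (1 / (2 * (n : ℝ) + 1)) * ∑ m ∈ Finset.Icc (-(n : ℤ)) n, L m +
        ∑ m ∈ Finset.Icc (-((n + 1 : ℕ) : ℤ)) ((n + 1 : ℕ) : ℤ), ((1 / (2 * (2 * (n : ℝ) + 1))) * ((if m ∈ Finset.Icc (-(n : ℤ) + 1) ((n : ℤ) + 1) then (1 : ℝ) else 0) + (if m ∈ Finset.Icc (-(n : ℤ) - 1) ((n : ℤ) - 1) then (1 : ℝ) else 0))) * L m := by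
  have hsub1 : Finset.Icc (-(n : ℤ) + 1) ((n : ℤ) + 1) ⊆ Finset.Icc (-((n + 1 : ℕ) : ℤ)) ((n + 1 : ℕ) : ℤ) := by
    intro m; simp only [Finset.mem_Icc]; push_cast; omega
  have hsub2 : Finset.Icc (-(n : ℤ) - 1) ((n : ℤ) - 1) ⊆ Finset.Icc (-((n + 1 : ℕ) : ℤ)) ((n + 1 : ℕ) : ℤ) := by
    intro m; simp only [Finset.mem_Icc]; push_cast; omega
  have hBE : ∑ m ∈ Finset.Icc (-((n + 1 : ℕ) : ℤ)) ((n + 1 : ℕ) : ℤ), ((1 / (2 * (2 * (n : ℝ) + 1))) * ((if m ∈ Finset.Icc (-(n : ℤ) + 1) ((n : ℤ) + 1) then (1 : ℝ) else 0) + (if m ∈ Finset.Icc (-(n : ℤ) - 1) ((n : ℤ) - 1) then (1 : ℝ) else 0))) * L m = (1 / (2 * (2 * (n : ℝ) + 1))) *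
      (∑ m ∈ Finset.Icc (-(n : ℤ) + 1) ((n : ℤ) + 1), L m + ∑ m ∈ Finset.Icc (-(n : ℤ) - 1) ((n : ℤ) - 1), L m) := by
    rw [← sum_indicator_mul hsub1 L, ← sum_indicator_mul hsub2 L, ← Finset.sum_add_distrib, Finset.mul_sum]
    refine Finset.sum_congr rfl fun m _ => ?_
    ring
  rw [hBE]
  push_cast at h1 h2
  have ht : (0 : ℝ) < 2 * (n : ℝ) + 1 := by positivity
  rw [← sub_nonneg]
  have key : (1 / (2 * (n : ℝ) + 1)) * ∑ m ∈ Finset.Icc (-(n : ℤ)) n, L m +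
      (1 / (2 * (2 * (n : ℝ) + 1))) * (∑ m ∈ Finset.Icc (-(n : ℤ) + 1) ((n : ℤ) + 1), L m +
        ∑ m ∈ Finset.Icc (-(n : ℤ) - 1) ((n : ℤ) - 1), L m) -
      (4 * E - C / (2 * (n : ℝ) + 1) + κ * ((1 / (2 * (n : ℝ) + 1)) * (J₁ + J₂))) =
      (1 / (2 * (2 * (n : ℝ) + 1))) *
        ((∑ m ∈ Finset.Icc (-(n : ℤ)) n, L m + ∑ m ∈ Finset.Icc (-(n : ℤ) + 1) ((n : ℤ) + 1), L m -
          (4 * (2 * (n : ℝ) + 1) * E - C + 2 * κ * J₁)) +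
        (∑ m ∈ Finset.Icc (-(n : ℤ) - 1) ((n : ℤ) - 1), L m + ∑ m ∈ Finset.Icc (-(n : ℤ)) n, L m -
          (4 * (2 * (n : ℝ) + 1) * E - C + 2 * κ * J₂))) := by
    field_simp
    ring
  rw [key]
  exact mul_nonneg (by positivity) (by linarith)

/-! ## (II3) The convexity instance -/

/-- **Convexity instance** (registered sub-goal `lms_convexity_instance`): there are `κ > 0` and
`C ≥ 0` such that for all fault-free normal-form data and all `n`,
`4 e* − C/(2n+1) + κ · VE n e ≤ AE n e + BE n e`. [folklore] -/
theorem lms_convexity_instance : ∃ κ C : ℝ, 0 < κ ∧ 0 ≤ C ∧ ∀ (n : ℕ) (e : LData), IsNormalData e → (∀ m : ℤ, e.2.2.1 (m + 1) = -e.2.2.1 m) → 4 * eStar - C / (2 * (n : ℝ) + 1) + κ * ((1 / (2 * (n : ℝ) + 1)) * (∑ l ∈ Finset.range (2 * n), ((e.2.2.2 ((-(n : ℤ) + l) + 1) - e.2.2.2 (-(n : ℤ) + l)) - (e.2.2.2 ((-(n : ℤ) + l) + 2) - e.2.2.2 ((-(n : ℤ) + l) + 1))) ^ 2 + ∑ l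 ∈ Finset.range (2 * n), ((e.2.2.2 ((-(n : ℤ) - 1 + l) + 1) - e.2.2.2 (-(n : ℤ) - 1 + l)) - (e.2.2.2 ((-(n : ℤ) - 1 + l) + 2) - e.2.2.2 ((-(n : ℤ) - 1 + l) + 1))) ^ 2)) ≤ ((1 / (2 * (n : ℝ) + 1)) * ∑ m ∈ Finset.Icc (-(n : ℤ)) n, (inLayerInteraction lennardJones e.2.1 + ∑' m' : ℤ, if m' = m then (0 : ℝ) else layerInteraction lennardJones e.2.1 (e.2.2.2 m' - e.2.2.2 m) (haggLabel e.2.2.1 m' - haggLabel e.2.2.1 m) 1)) + (∑ m ∈ Finset.Icc (-((n + 1 : ℕ) : ℤ)) ((n + 1 : ℕ) : ℤ), ((1 / (2 * (2 * (n : ℝ) + 1))) * ((if m ∈ Finset.Icc (-(n : ℤ) + 1) ((n : ℤ) + 1) then (1 : ℝ) else 0) + (if m ∈ Finset.Icc (-(n : ℤ) - 1) ((n : ℤ) - 1) then (1 : ℝ) else 0))) * (inLayerInteraction lennardJones e.2.1 + ∑' m' : ℤ, if m' = m then (0 : ℝ) else layerInteraction lennardJones e.2.1 (e.2.2.2 m'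 - e.2.2.2 m) (haggLabel e.2.2.1 m' - haggLabel e.2.2.1 m) 1)) := by
  obtain ⟨CW, hCW⟩ := SlackRigidityPricedFloorsWindow.lms_window_sum_ge
    SlackRigidityPricedFloorsWindowLower.stub_windowLowerBound
  obtain ⟨κ, C, hκ, hC, hconv⟩ := SlackRigidityPricedFloorsConvexWindows.lms_convex_windows CW
    (fun a s z ha ha1 hz m₁ n => hCW LinearIsometry.id a s z ha ha1 hz m₁ n)
  refine ⟨κ, C, hκ, hC, fun n e he hfree => ?_⟩
  obtain ⟨-, ⟨ha, ha1, hs, hz⟩, -⟩ := he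
  obtain ⟨w1, w2, w3, w4⟩ := windows_eq n
  have h1 := hconv e.2.1 e.2.2.1 e.2.2.2 ha ha1 hs hfree hz (-(n : ℤ)) (2 * n)
  have h2 := hconv e.2.1 e.2.2.1 e.2.2.2 ha ha1 hs hfree hz (-(n : ℤ) - 1) (2 * n)
  rw [w1, w2] at h1
  rw [w3, w4] at h2
  exact convexity_arith h1 h2

/-! ## (II4) The edge bound and crude bounds -/

/-- One squared increment jump of normal data is at most `49/10⁴`. [folklore] -/
theorem jump_le {e : LData} (he : IsNormalData e) (i : ℤ) :
    ((e.2.2.2 (i + 1) - e.2.2.2 i) - (e.2.2.2 (i + 2) - e.2.2.2 (i + 1))) ^ 2 ≤ 49 / 10000 := by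
  obtain ⟨-, ⟨ha, ha1, -, hz⟩, -⟩ := he
  have h1 := hz i
  have h2 := hz (i + 1)
  rw [show i + 1 + 1 = i + 2 by ring] at h2
  have hlo : -(7 / 100 : ℝ) ≤ (e.2.2.2 (i + 1) - e.2.2.2 i) - (e.2.2.2 (i + 2) - e.2.2.2 (i + 1)) := by
    linarith [h1.1, h2.2]
  have hhi : (e.2.2.2 (i + 1) - e.2.2.2 i) - (e.2.2.2 (i + 2) - e.2.2.2 (i + 1)) ≤ 7 / 100 := by
    linarith [h1.2, h2.1]
  nlinarith

/-- The bottom edge jump in normalised indices is at most `49/10⁴`. [folklore] -/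
theorem jump_le' {e : LData} (he : IsNormalData e) (m : ℤ) :
    ((e.2.2.2 (m - 1) - e.2.2.2 (m - 2)) - (e.2.2.2 m - e.2.2.2 (m - 1))) ^ 2 ≤ 49 / 10000 := by
  have h := jump_le he (m - 2)
  rw [show m - 2 + 1 = m - 1 by ring, show m - 2 + 2 = m by ring] at h
  exact h

/-- A window sum of jumps is at most `49/10⁴` per term. [folklore] -/
theorem sum_jump_le {e : LData} (he : IsNormalData e) (a : ℤ) (k : ℕ) :
    ∑ l ∈ Finset.range k, ((e.2.2.2 (a + l + 1) - e.2.2.2 (a + l)) -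
      (e.2.2.2 (a + l + 2) - e.2.2.2 (a + l + 1))) ^ 2 ≤ k * (49 / 10000) := by
  have h := Finset.sum_le_sum (s := Finset.range k) fun l _ => jump_le he (a + l)
  rw [Finset.sum_const, Finset.card_range, nsmul_eq_mul] at h
  exact h

/-- **The edge bound** (registered sub-goal `lms_Dt_le`): `DtE n e ≤ 2 · VE n e + 1/(2n+1)` on
normal-form data (the two averages differ by the edge jumps `jump e n` and `jump e (−n−2)`).
[folklore] -/
theorem lms_Dt_le : ∀ (n : ℕ) (e : LData), IsNormalData e → ((1 / (2 * (n : ℝ) + 1)) * ∑ m ∈ Finset.Icc (-(n : ℤ)) n, (((e.2.2.2 (m + 1) - e.2.2.2 m) - (e.2.2.2 (m + 2) - e.2.2.2 (m + 1))) ^ 2 + ((e.2.2.2 (m - 1) - e.2.2.2 (m - 2)) - (e.2.2.2 m - e.2.2.2 (m - 1))) ^ 2)) ≤ 2 * ((1 / (2 * (n : ℝ) + 1)) * (∑ l ∈ Finset.range (2 * n), ((e.2.2.2 ((-(n : ℤ) + l) + 1) - e.2.2.2 (-(n : ℤ) + l)) - (e.2.2.2 ((-(n : ℤ) + l) + 2)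 - e.2.2.2 ((-(n : ℤ) + l) + 1))) ^ 2 + ∑ l ∈ Finset.range (2 * n), ((e.2.2.2 ((-(n : ℤ) - 1 + l) + 1) - e.2.2.2 (-(n : ℤ) - 1 + l)) - (e.2.2.2 ((-(n : ℤ) - 1 + l) + 2) - e.2.2.2 ((-(n : ℤ) - 1 + l) + 1))) ^ 2)) + 1 / (2 * (n : ℝ) + 1) := by
  intro n e he
  rw [Finset.sum_add_distrib, sum_jump_split_top e.2.2.2 n, sum_jump_split_bot e.2.2.2 n]
  have ht : (0 : ℝ) < 2 * (n : ℝ) + 1 := by positivity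
  have hJ1 := sum_jump_le he (-(n : ℤ)) (2 * n)
  have hJ2 := sum_jump_le he (-(n : ℤ) - 1) (2 * n)
  have hJ1nn : 0 ≤ ∑ l ∈ Finset.range (2 * n), ((e.2.2.2 (-(n : ℤ) + l + 1) - e.2.2.2 (-(n : ℤ) + l)) -
      (e.2.2.2 (-(n : ℤ) + l + 2) - e.2.2.2 (-(n : ℤ) + l + 1))) ^ 2 :=
    Finset.sum_nonneg fun l _ => sq_nonneg _
  have hJ2nn : 0 ≤ ∑ l ∈ Finset.range (2 * n), ((e.2.2.2 (-(n : ℤ) - 1 + l + 1) - e.2.2.2 (-(n : ℤ) - 1 + l)) -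
      (e.2.2.2 (-(n : ℤ) - 1 + l + 2) - e.2.2.2 (-(n : ℤ) - 1 + l + 1))) ^ 2 :=
    Finset.sum_nonneg fun l _ => sq_nonneg _
  have htop := jump_le he (n : ℤ)
  have hbot := jump_le' he (-(n : ℤ))
  rw [← sub_nonneg]
  have key : 2 * ((1 / (2 * (n : ℝ) + 1)) *
      (∑ l ∈ Finset.range (2 * n), ((e.2.2.2 (-(n : ℤ) + l + 1) - e.2.2.2 (-(n : ℤ) + l)) -
        (e.2.2.2 (-(n : ℤ) + l + 2) - e.2.2.2 (-(n : ℤ) + l + 1))) ^ 2 +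
      ∑ l ∈ Finset.range (2 * n), ((e.2.2.2 (-(n : ℤ) - 1 + l + 1) - e.2.2.2 (-(n : ℤ) - 1 + l)) -
        (e.2.2.2 (-(n : ℤ) - 1 + l + 2) - e.2.2.2 (-(n : ℤ) - 1 + l + 1))) ^ 2)) + 1 / (2 * (n : ℝ) + 1) -
      (1 / (2 * (n : ℝ) + 1)) *
      (∑ l ∈ Finset.range (2 * n), ((e.2.2.2 (-(n : ℤ) + l + 1) - e.2.2.2 (-(n : ℤ) + l)) -
        (e.2.2.2 (-(n : ℤ) + l + 2) - e.2.2.2 (-(n : ℤ) + l + 1))) ^ 2 +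
        ((e.2.2.2 ((n : ℤ) + 1) - e.2.2.2 n) - (e.2.2.2 ((n : ℤ) + 2) - e.2.2.2 ((n : ℤ) + 1))) ^ 2 +
      (((e.2.2.2 (-(n : ℤ) - 1) - e.2.2.2 (-(n : ℤ) - 2)) - (e.2.2.2 (-(n : ℤ)) - e.2.2.2 (-(n : ℤ) - 1))) ^ 2 +
        ∑ l ∈ Finset.range (2 * n), ((e.2.2.2 (-(n : ℤ) - 1 + l + 1) - e.2.2.2 (-(n : ℤ) - 1 + l)) -
          (e.2.2.2 (-(n : ℤ) - 1 + l + 2) - e.2.2.2 (-(n : ℤ) - 1 + l + 1))) ^ 2)) =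
      (1 / (2 * (n : ℝ) + 1)) *
      ((∑ l ∈ Finset.range (2 * n), ((e.2.2.2 (-(n : ℤ) + l + 1) - e.2.2.2 (-(n : ℤ) + l)) -
        (e.2.2.2 (-(n : ℤ) + l + 2) - e.2.2.2 (-(n : ℤ) + l + 1))) ^ 2 +
        ∑ l ∈ Finset.range (2 * n), ((e.2.2.2 (-(n : ℤ) - 1 + l + 1) - e.2.2.2 (-(n : ℤ) - 1 + l)) -
          (e.2.2.2 (-(n : ℤ) - 1 + l + 2) - e.2.2.2 (-(n : ℤ) - 1 + l + 1))) ^ 2) +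
        (1 - ((e.2.2.2 ((n : ℤ) + 1) - e.2.2.2 n) - (e.2.2.2 ((n : ℤ) + 2) - e.2.2.2 ((n : ℤ) + 1))) ^ 2 -
          ((e.2.2.2 (-(n : ℤ) - 1) - e.2.2.2 (-(n : ℤ) - 2)) - (e.2.2.2 (-(n : ℤ)) - e.2.2.2 (-(n : ℤ) - 1))) ^ 2)) := by
    ring
  rw [key]
  exact mul_nonneg (by positivity) (by linarith)

/-- **Crude bounds** (registered sub-goal `lms_jump_functional_bounds`): on normal-form data the
jump functionals `VE n e`, `DtE n e`, `DE e` take values in `[0, 1]`. [folklore] -/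
theorem lms_jump_functional_bounds : ∀ (n : ℕ) (e : LData), IsNormalData e → (0 ≤ ((1 / (2 * (n : ℝ) + 1)) * (∑ l ∈ Finset.range (2 * n), ((e.2.2.2 ((-(n : ℤ) + l) + 1) - e.2.2.2 (-(n : ℤ) + l)) - (e.2.2.2 ((-(n : ℤ) + l) + 2) - e.2.2.2 ((-(n : ℤ) + l) + 1))) ^ 2 + ∑ l ∈ Finset.range (2 * n), ((e.2.2.2 ((-(n : ℤ) - 1 + l) + 1) - e.2.2.2 (-(n : ℤ) - 1 + l)) - (e.2.2.2 ((-(n : ℤ) - 1 + l) + 2) - e.2.2.2 ((-(n : ℤ) - 1 + l) + 1))) ^ 2)) ∧ ((1 / (2 * (n : ℝ) + 1)) * (∑ l ∈ Finset.range (2 * n), ((e.2.2.2 ((-(n : ℤ) + l) + 1) - e.2.2.2 (-(n : ℤ) + l)) - (e.2.2.2 ((-(n : ℤ) + l) + 2) - e.2.2.2 ((-(n : ℤ) + l) + 1))) ^ 2 + ∑ l ∈ Finset.range (2 * n), ((e.2.2.2 ((-(n : ℤ) - 1 + l) + 1) - e.2.2.2 (-(n : ℤ) - 1 + l)) - (e.2.2.2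 ((-(n : ℤ) - 1 + l) + 2) - e.2.2.2 ((-(n : ℤ) - 1 + l) + 1))) ^ 2)) ≤ 1) ∧ (0 ≤ ((1 / (2 * (n : ℝ) + 1)) * ∑ m ∈ Finset.Icc (-(n : ℤ)) n, (((e.2.2.2 (m + 1) - e.2.2.2 m) - (e.2.2.2 (m + 2) - e.2.2.2 (m + 1))) ^ 2 + ((e.2.2.2 (m - 1) - e.2.2.2 (m - 2)) - (e.2.2.2 m - e.2.2.2 (m - 1))) ^ 2)) ∧ ((1 / (2 * (n : ℝ) + 1)) * ∑ m ∈ Finset.Icc (-(n : ℤ)) n, (((e.2.2.2 (m + 1) - e.2.2.2 m) - (e.2.2.2 (m + 2) - e.2.2.2 (m + 1))) ^ 2 + ((e.2.2.2 (m - 1) - e.2.2.2 (m - 2)) - (e.2.2.2 m - e.2.2.2 (m - 1))) ^ 2)) ≤ 1) ∧ (0 ≤ ((e.2.2.2 1 - e.2.2.2 0) - (e.2.2.2 2 - e.2.2.2 1)) ^ 2 + ((e.2.2.2 (-1) - e.2.2.2 (-2)) - (e.2.2.2 0 - e.2.2.2 (-1))) ^ 2 ∧ ((e.2.2.2 1 -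 e.2.2.2 0) - (e.2.2.2 2 - e.2.2.2 1)) ^ 2 + ((e.2.2.2 (-1) - e.2.2.2 (-2)) - (e.2.2.2 0 - e.2.2.2 (-1))) ^ 2 ≤ 1) := by
  intro n e he
  have ht : (0 : ℝ) < 2 * (n : ℝ) + 1 := by positivity
  have hJ1 := sum_jump_le he (-(n : ℤ)) (2 * n)
  have hJ2 := sum_jump_le he (-(n : ℤ) - 1) (2 * n)
  have hJ1nn : 0 ≤ ∑ l ∈ Finset.range (2 * n), ((e.2.2.2 (-(n : ℤ) + l + 1) - e.2.2.2 (-(n : ℤ) + l)) -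
      (e.2.2.2 (-(n : ℤ) + l + 2) - e.2.2.2 (-(n : ℤ) + l + 1))) ^ 2 :=
    Finset.sum_nonneg fun l _ => sq_nonneg _
  have hJ2nn : 0 ≤ ∑ l ∈ Finset.range (2 * n), ((e.2.2.2 (-(n : ℤ) - 1 + l + 1) - e.2.2.2 (-(n : ℤ) - 1 + l)) -
      (e.2.2.2 (-(n : ℤ) - 1 + l + 2) - e.2.2.2 (-(n : ℤ) - 1 + l + 1))) ^ 2 :=
    Finset.sum_nonneg fun l _ => sq_nonneg _
  have hVE : 0 ≤ ((1 / (2 * (n : ℝ) + 1)) * (∑ l ∈ Finset.range (2 * n), ((e.2.2.2 ((-(n : ℤ) + l) + 1) - e.2.2.2 (-(n : ℤ) + l)) - (e.2.2.2 ((-(n : ℤ) + l) + 2) - e.2.2.2 ((-(n : ℤ) + l) + 1))) ^ 2 + ∑ l ∈ Finset.range (2 * n), ((e.2.2.2 ((-(n : ℤ) - 1 + l) + 1) - e.2.2.2 (-(n : ℤ) - 1 + l)) - (e.2.2.2 ((-(n : ℤ) - 1 + l) + 2) - e.2.2.2 ((-(n : ℤ) - 1 + l) + 1))) ^ 2)) ∧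 ((1 / (2 * (n : ℝ) + 1)) * (∑ l ∈ Finset.range (2 * n), ((e.2.2.2 ((-(n : ℤ) + l) + 1) - e.2.2.2 (-(n : ℤ) + l)) - (e.2.2.2 ((-(n : ℤ) + l) + 2) - e.2.2.2 ((-(n : ℤ) + l) + 1))) ^ 2 + ∑ l ∈ Finset.range (2 * n), ((e.2.2.2 ((-(n : ℤ) - 1 + l) + 1) - e.2.2.2 (-(n : ℤ) - 1 + l)) - (e.2.2.2 ((-(n : ℤ) - 1 + l) + 2) - e.2.2.2 ((-(n : ℤ) - 1 + l) + 1))) ^ 2)) ≤ 1 := by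
    refine ⟨by positivity, ?_⟩
    rw [one_div_mul_eq_div, div_le_one ht]
    push_cast at hJ1 hJ2
    nlinarith
  have hDt := lms_Dt_le n e he
  refine ⟨hVE, ⟨?_, ?_⟩, ⟨by positivity, ?_⟩⟩
  · exact mul_nonneg (by positivity) (Finset.sum_nonneg fun m _ => add_nonneg (sq_nonneg _) (sq_nonneg _))
  · -- direct: every term is at most `2 · 49/10⁴`
    have hsum : ∑ m ∈ Finset.Icc (-(n : ℤ)) n, (((e.2.2.2 (m + 1) - e.2.2.2 m) - (e.2.2.2 (m + 2) - e.2.2.2 (m + 1))) ^ 2 + ((e.2.2.2 (m - 1) - e.2.2.2 (m - 2)) - (e.2.2.2 m - e.2.2.2 (m - 1))) ^ 2) ≤ (Finset.Icc (-(n : ℤ)) n).card * (2 * (49 / 10000)) := by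
      have h := Finset.sum_le_sum (s := Finset.Icc (-(n : ℤ)) n) fun m _ => add_le_add (jump_le he m) (jump_le' he m)
      rw [Finset.sum_const, nsmul_eq_mul] at h
      linarith
    have hcard : ((Finset.Icc (-(n : ℤ)) n).card : ℝ) = 2 * (n : ℝ) + 1 := by
      rw [Int.card_Icc]
      have h : ((n : ℤ) + 1 - -(n : ℤ)).toNat = 2 * n + 1 := by omega
      rw [h]; push_cast; ring
    rw [hcard] at hsum
    rw [one_div_mul_eq_div, div_le_one ht]
    nlinarith
  · have h0 := jump_le he 0
    have h2 := jump_le' he 0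
    norm_num at h0 h2
    linarith

end Summit.AtomisticToContinuum.Crystallization.Theorems.SlackRigidityPricedFloorsIncrIdent

end
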